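/-
Copyright (c) 2026 the pub-hodgecm-mathlib formalisation cell (harness21).  Prover seat hodgecm-mathlib-K2E3-p28 (g3) (E3 hand lent to strike line L1 by CHAIR K2-lead (g2)
VALVE WORD W4; LEAD F0P6-plan (g14) BATCH #108 (3) ∕ #138 (2); desk K2E3-p14 (g9) 23:20:41Z «the `hpure` glue at the #31s head is YOURS»), Track B «K2-LIT» ∕
hLiu418 = stmt-HodgeConjecture-24832: organ U1-CT-ind stage 3 («U1-glob»), brick B2b FILE 3 — THE STANDARD EXTENSION OF A SECTION PURE AT `v₀` IS PURE AT `v₀`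
ON THE SLICE `placesEmbed_T`, WITH THE LOCAL FACTOR = THE FLAT FAMILY `H_{v₀}^{2(s−s₀)}·b` OF RECORD.  THEOREMS ONLY.
-/
import Summits.HodgeConjecture.HodgeConjecture.Theorems.K2LiuStdFamilyAwayPurityFlat   -- ★ (E6′) (K2Liu-p03): `heightTwistLoc_siegel ∕ _smooth`, brings ★ (E6) `modDelta_pPart_placesEmbed`, ★ `placesEmbed_one_mulSingle`
import Mathlib.Data.Fintype.BigOperators
import HarnessLib

/-!
# Crux `HLiu418`, organ U1-CT-ind STAGE 3 («U1-glob»), brick B2b FILE 3: `stdExtension 𝒦 s₀ (a ⊗_{v₀} b)` IS PURE AT `v₀` ON THE SLICE — the `hpure` letter of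
# ★ B2b FILE 2 `K2LiuSingularWhittakerPlaceFactorEuler.whittakerDelta_eq_localFactor_mul_of_pureAt` at the #31s head, with `bT :=` the flat family `H_{v₀}(·)^{2(s−s₀)}·b`

Cell `hodgecm-mathlib`, crux item hLiu418 = `stmt-HodgeConjecture-24832`; squad K2, strike line L1, LEAD F0P6-plan (g14); desk K2E3-p14 (g9) (B4 pen); prover K2E3-p28 (g3).
Lane `--supports stmt-HodgeConjecture-24832 --as helper` (count-neutral).  THEOREMS ONLY (no `def`, no `instance`, no notation, no named-fact hypothesis, no `sorry`).

THE POINT (desk K2E3-p14 (g9) 23:20:41Z).  ★ #31s `K2LiuStdFamilyFactorisable.stdFamilyFactorisable` makes a standard family `f` factorizable off `T` with HEAD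
`fT s x := f s (placesEmbed_T x)`; ★ B2b FILE 2 wants that head PURE AT `v₀ ∈ T`: `fT s (y_∞, y) = bT s (y v₀) · rT s (y_∞, y|_{w ≠ v₀})`.  For U1-glob's ONE pure term
`φ h = a (h · ι_{v₀}(h_{v₀})⁻¹) · b (h_{v₀})` (★ `exists_sum_pure_at_of_isStandardSectionFamily`'s summand form; `h_{v₀} := (h_f)_{v₀}`) and `f := stdExtension 𝒦 s₀ φ`
(★ O42.3d: `f s h = M(h)^{2(s−s₀)} · φ h`, `M := modDelta ∘ 𝒦.pPart`), this file proves it with THE LOCAL FACTOR OF RECORD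
  `bT s y := H_{v₀}(y)^{2(s−s₀)} · b y`,   `H_{v₀}(y) := M(ι_{v₀} y)`
— exactly ★ (E6′) `K2LiuStdFamilyAwayPurityFlat`'s flat local family (`heightTwistLoc_*`), so that LH7-p06 (g2)'s ★ local reading `K2LiuSingularWhittakerLocalReading` and K2E3-p06 (g6)'s
B2a′ act on ONE AND THE SAME local object — and `rT s (y_∞, y') := M(X)^{2(s−s₀)} · a X`, `X := placesEmbed_T (y_∞, y' extended by 1 at v₀)`:
* §1 **`stdExtension_placesEmbed_eq_mul_of_pureAt`** — for `𝒦` standard (+ the level guard `(𝒦.K)_v ⊆ K_{H,v}` off `T` of ★ (E6)) and `φ` pure at `v₀` as above: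
  `stdExtension 𝒦 s₀ φ s (placesEmbed_T (y_∞, y)) = (H_{v₀}(y v₀)^{2(s−s₀)} · b (y v₀)) · (M(X)^{2(s−s₀)} · a X)` — ★ B2b FILE 2's `hpure` TOKEN FOR TOKEN (`bT`, `rT` explicit).
  MECHANISM: `(y_∞, y) = (y_∞, y[v₀ ↦ 1]) · (1, y v₀ at v₀)` in `H_∞ × ∏_{v∈T} H_v`, so `placesEmbed_T (y_∞, y) = X · ι_{v₀}(y v₀)` (★ `placesEmbed_one_mulSingle`); hence
  `h_{v₀} = y v₀` (★ `evalPlace_finPart_placesEmbed_of_mem`) and `h · ι_{v₀}(h_{v₀})⁻¹ = X`; the height splits `M(placesEmbed_T (y_∞, y)) = M(X) · H_{v₀}(y v₀)` by ★ (E6)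
  `modDelta_pPart_placesEmbed` (applied to `y` and to `y[v₀ ↦ 1]`, `M(ι_{v₀} 1) = 1`) — no local Iwasawa data, no saturation hypothesis.
* §2 **`exists_pureAt_placesEmbed_flat`** — the same packaged with the FLAT-FAMILY LETTERS OF `bT` exported as conjuncts (desk: «not hidden behind `∃`»): Siegel law at every
  `s` (★ `heightTwistLoc_siegel`), smooth (★ `heightTwistLoc_smooth`), flat on `ι_{v₀}⁻¹(𝒦.K)` (★ `IwasawaDatum.modDelta_pPart_of_mem_K`), `bT s₀ = b`, and the defining formula.
* §0 `mul_prod_eq_apply_mul` — the trivial algebra turning ★ (E6′)'s FULL-TENSOR summand `A(y_∞) · ∏_{v∈T} B_v(y v)` into FILE 2's `hpure` shape (road-B friendly).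
References: [Tan1999] V. Tan, Canad. J. Math. 51 (1999), §1 p. 166 (`Φ(g,s) = Φ_v ⊗ Φ^v`); [KudlaRallis1994] §1; [HarrisKudlaSweet1996] §1 (1.15)–(1.17); [BorelJacquet1979] §4.1;
[KudlaSweet1997] §1 (flat = standard sections).
HONEST LABEL.  Count-neutral helper: `HC_CM` is proved only modulo the 7 printed citations (2 remaining named inputs: hLiu418 = `stmt-HodgeConjecture-24832`,
h413 = `stmt-HodgeConjecture-24833`) until rung 0 closes; U1-glob itself stays OPEN (B2a′, B4, B5).
-/

set_option autoImplicit false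
set_option linter.dupNamespace false -- the mandated namespace repeats `HodgeConjecture.HodgeConjecture`

noncomputable section

open scoped Matrix RestrictedProduct BigOperators
open Filter Topology Set NumberField IsDedekindDomain
open Literature.NumberTheory.Automorphic Literature.NumberTheory.Automorphic.UnitaryGroup Literature.NumberTheory.GaloisRepresentations
open Literature.NumberTheory.GelbartRogawski1991 Literature.NumberTheory.GelbartRogawski1991.GRConstruction
open Literature.NumberTheory.GelbartRogawski1991.UnitaryDualPair
open Literature.NumberTheory.K2Lit.SiegelDoubled Literature.NumberTheory.K2Lit.LocalSiegelDoubled Literature.NumberTheory.K2Lit.PlaceSplitting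
open Summit.HodgeConjecture.HodgeConjecture.Cruxes.HLiu418.K2LiuStdFamilyFactorisable
open Summit.HodgeConjecture.HodgeConjecture.Cruxes.HLiu418.K2LiuIwasawaDeltaUnimodular
open Summit.HodgeConjecture.HodgeConjecture.Cruxes.HLiu418.K2LiuSiegelBigCellSectionOfLocalPrelims
open Summit.HodgeConjecture.HodgeConjecture.Cruxes.HLiu418.K2LiuIwasawaHeightPlaceFactorisation
open Summit.HodgeConjecture.HodgeConjecture.Cruxes.HLiu418.K2LiuStdFamilyAwayPurityFlat

namespace Summit.HodgeConjecture.HodgeConjecture.Cruxes.HLiu418.K2LiuStdExtensionPureAt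

/-! ## §0 The full-tensor summand is pure at every coordinate (road-B shape of ★ (E6′)) -/

/-- **a full tensor `A a · ∏_i B_i(q i)` is pure at `i₀`**: `= B_{i₀}(q i₀) · (A a · ∏_{i ≠ i₀} B_i(q i))` — ★ (E6′) `exists_awayPurity_flat`'s summand in ★ B2b FILE 2's `hpure` shape.
[cite: Tan1999, §1 p. 166] -/
theorem mul_prod_eq_apply_mul {ι : Type*} [Fintype ι] [DecidableEq ι] {α : ι → Type*} {Ar : Type*} (A : Ar → ℂ) (B : ∀ i, α i → ℂ) (i₀ : ι) (a : Ar) (q : ∀ i, α i) :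
    A a * ∏ i, B i (q i) = B i₀ (q i₀) * (A a * ∏ i : {i // i ≠ i₀}, B i.1 (q i.1)) := by
  rw [Fintype.prod_eq_mul_prod_subtype_ne (fun i => B i (q i)) i₀]
  ring

/-! ## §1 The standard extension of a section pure at `v₀` is pure at `v₀` on the slice -/

variable (L : Type) [Field L] [NumberField L] [IsCMField L]
variable {N M n : ℕ} (e : Fin N × Fin M ≃ Fin n)
  (dV : Fin N → L) (hdV : ∀ i, IsCMField.complexConj L (dV i) = dV i) (hdV0 : ∀ i, dV i ≠ 0)
  (dW : Fin M → L) (hdW : ∀ i, IsCMField.complexConj L (dW i) = dW i) (hdW0 : ∀ i, dW i ≠ 0)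
  (T : Finset (HeightOneSpectrum (𝓞 (Fp L)))) [DecidableEq (HeightOneSpectrum (𝓞 (Fp L)))]

set_option maxHeartbeats 800000 in -- MEASURED: fails at 400 000 (`whnf` on the statement's adelic telescope + `isDefEq` at the height split), passes at 800 000 = ★ (E6)∕(E6′)'s class; `rw`∕`exact` only
include hdV0 hdW0 in
/-- **THE STANDARD EXTENSION OF A SECTION PURE AT `v₀` IS PURE AT `v₀` ON THE SLICE.**  `𝒦` standard with `(𝒦.K)_v ⊆ K_{H,v}` off `T` (★ (E6)'s guard), `v₀ ∈ T`,
`φ h = a (h · ι_{v₀}(h_{v₀})⁻¹) · b (h_{v₀})` for all `h`.  Then for every `s, y_∞, y`: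
`stdExtension 𝒦 s₀ φ s (placesEmbed_T (y_∞, y)) = (H_{v₀}(y v₀)^{2(s−s₀)} · b (y v₀)) · (M(X)^{2(s−s₀)} · a X)`, `X := placesEmbed_T (y_∞, y[v₀ ↦ 1])`, `H_{v₀}(u) := M(ι_{v₀} u)`,
`M := modDelta ∘ 𝒦.pPart` — ★ B2b FILE 2's `hpure` with `bT s u := H_{v₀}(u)^{2(s−s₀)} · b u` (★ (E6′)'s flat local family) and `rT s (y_∞, y') := M(X)^{2(s−s₀)} · a X`.
[cite: Tan1999, §1 p. 166] [cite: KudlaRallis1994, §1] [cite: HarrisKudlaSweet1996, §1 (1.17)] [cite: BorelJacquet1979, §4.1] -/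
theorem stdExtension_placesEmbed_eq_mul_of_pureAt {𝒦 : IwasawaDatum L e dV hdV dW hdW} (h𝒦 : 𝒦.IsStd)
    (hKT : ∀ k ∈ 𝒦.K, ∀ v, v ∉ T → UnitaryGroup.evalPlace (Fp L) L (IsCMField.complexConj L) (n + n) (hermD L e dV hdV dW hdW) v (UnitaryGroup.finPart (Fp L) L (IsCMField.complexConj L) (n + n) (hermD L e dV hdV dW hdW) k) ∈ UnitaryGroup.localInt L (IsCMField.complexConj L) (n + n) (hermD L e dV hdV dW hdW) v)
    (v₀ : T) (s₀ : ℂ) {φ a : HA L e dV hdV dW hdW → ℂ} {b : UnitaryGroup.localPi L (IsCMField.complexConj L) (n + n) (hermD L e dV hdV dW hdW) v₀.1 → ℂ}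
    (hφ : ∀ h : HA L e dV hdV dW hdW,
      φ h = a (h * (locToAdelic L e dV hdV dW hdW v₀.1 (UnitaryGroup.evalPlace (Fp L) L (IsCMField.complexConj L) (n + n) (hermD L e dV hdV dW hdW) v₀.1 (UnitaryGroup.finPart (Fp L) L (IsCMField.complexConj L) (n + n) (hermD L e dV hdV dW hdW) h)))⁻¹) *
        b (UnitaryGroup.evalPlace (Fp L) L (IsCMField.complexConj L) (n + n) (hermD L e dV hdV dW hdW) v₀.1 (UnitaryGroup.finPart (Fp L) L (IsCMField.complexConj L) (n + n) (hermD L e dV hdV dW hdW) h)))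
    (s : ℂ) (yi : UnitaryGroup.arch (Fp L) L (IsCMField.complexConj L) (n + n) (hermD L e dV hdV dW hdW))
    (y : Π v : T, UnitaryGroup.localPi L (IsCMField.complexConj L) (n + n) (hermD L e dV hdV dW hdW) v.1) :
    stdExtension 𝒦 s₀ φ s (placesEmbed L (hermD L e dV hdV dW hdW) T (yi, y)) =
      ((((modDelta L e dV hdV dW hdW (𝒦.pPart (locToAdelic L e dV hdV dW hdW v₀.1 (y v₀)))) : ℝ) : ℂ) ^ (2 * (s - s₀)) * b (y v₀)) *
        ((((modDelta L e dV hdV dW hdW (𝒦.pPart (placesEmbed L (hermD L e dV hdV dW hdW) T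
              (yi, fun v : T => if _hv : v = v₀ then (1 : UnitaryGroup.localPi L (IsCMField.complexConj L) (n + n) (hermD L e dV hdV dW hdW) v.1) else y v)))) : ℝ) : ℂ) ^ (2 * (s - s₀)) *
          a (placesEmbed L (hermD L e dV hdV dW hdW) T
              (yi, fun v : T => if _hv : v = v₀ then (1 : UnitaryGroup.localPi L (IsCMField.complexConj L) (n + n) (hermD L e dV hdV dW hdW) v.1) else y v))) := by
  -- the tuple with the `v₀`-coordinate replaced by `1`
  set upd : Π v : T, UnitaryGroup.localPi L (IsCMField.complexConj L) (n + n) (hermD L e dV hdV dW hdW) v.1 :=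
    fun v : T => if _hv : v = v₀ then (1 : UnitaryGroup.localPi L (IsCMField.complexConj L) (n + n) (hermD L e dV hdV dW hdW) v.1) else y v with hupd
  have hupd₀ : upd v₀ = 1 := by rw [hupd]; exact dif_pos rfl
  have hupd₁ : ∀ (w : HeightOneSpectrum (𝓞 (Fp L))) (hw : w ∈ T), (⟨w, hw⟩ : T) ≠ v₀ → upd ⟨w, hw⟩ = y ⟨w, hw⟩ := fun w hw hne => by
    rw [hupd]; exact dif_neg hne
  -- the two slice points, read in `H(𝔸)` (★ (E6)'s typing discipline: name them as elements of `HA`)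
  obtain ⟨X, hX⟩ : ∃ X : HA L e dV hdV dW hdW, X = placesEmbed L (hermD L e dV hdV dW hdW) T (yi, upd) := ⟨_, rfl⟩
  obtain ⟨h₀, hh₀⟩ : ∃ h₀ : HA L e dV hdV dW hdW, h₀ = placesEmbed L (hermD L e dV hdV dW hdW) T (yi, y) := ⟨_, rfl⟩
  -- (1) `placesEmbed_T (y_∞, y) = X · ι_{v₀}(y v₀)` — componentwise (archimedean part, then every finite place), as ★ `placesEmbed_one_mulSingle`
  have hemb : h₀ = X * locToAdelic L e dV hdV dW hdW v₀.1 (y v₀) := by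
    refine eq_of_archPart_eq_of_finPart_eq L e dV hdV dW hdW _ _ ?_ ?_
    · rw [archPart_mul', hh₀, hX, archPart_placesEmbed, archPart_placesEmbed, archPart_locToAdelic, mul_one]
    · refine UnitaryGroup.eq_of_forall_evalPlace_eq (Fp L) L (IsCMField.complexConj L) (n + n) (hermD L e dV hdV dW hdW) fun w => ?_
      rw [evalPlace_finPart_mul', hh₀, hX]
      by_cases hw : w ∈ T
      · rw [evalPlace_finPart_placesEmbed_of_mem L e dV hdV dW hdW T yi y w hw, evalPlace_finPart_placesEmbed_of_mem L e dV hdV dW hdW T yi upd w hw]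
        by_cases hw0 : (⟨w, hw⟩ : T) = v₀
        · have hwv : w = v₀.1 := congrArg Subtype.val hw0
          subst hwv
          rw [evalPlace_finPart_locToAdelic_self, show upd ⟨v₀.1, hw⟩ = 1 from hupd₀, one_mul]
        · have hwv : w ≠ v₀.1 := fun h => hw0 (Subtype.ext h)
          rw [evalPlace_finPart_locToAdelic_of_ne L e dV hdV dW hdW hwv, mul_one, hupd₁ w hw hw0]
      · have hwv : w ≠ v₀.1 := fun h => hw (h ▸ v₀.2)
        rw [evalPlace_finPart_placesEmbed_of_not_mem L e dV hdV dW hdW T yi y w hw, evalPlace_finPart_placesEmbed_of_not_mem L e dV hdV dW hdW T yi upd w hw,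
          evalPlace_finPart_locToAdelic_of_ne L e dV hdV dW hdW hwv, mul_one]
  -- (2) the `v₀`-component and the away part
  have hv0 : UnitaryGroup.evalPlace (Fp L) L (IsCMField.complexConj L) (n + n) (hermD L e dV hdV dW hdW) v₀.1
      (UnitaryGroup.finPart (Fp L) L (IsCMField.complexConj L) (n + n) (hermD L e dV hdV dW hdW) h₀) = y v₀ := by
    rw [hh₀]; exact evalPlace_finPart_placesEmbed_of_mem L e dV hdV dW hdW T yi y v₀.1 v₀.2
  have haway : h₀ * (locToAdelic L e dV hdV dW hdW v₀.1 (UnitaryGroup.evalPlace (Fp L) L (IsCMField.complexConj L) (n + n) (hermD L e dV hdV dW hdW) v₀.1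
        (UnitaryGroup.finPart (Fp L) L (IsCMField.complexConj L) (n + n) (hermD L e dV hdV dW hdW) h₀)))⁻¹ = X := by
    rw [hv0, hemb, mul_inv_cancel_right]
  -- (3) the height splits: `M(h₀) = M(X) · H_{v₀}(y v₀)`
  have hK : 𝒦.IsDeltaUnimodular := IwasawaDatum.modDelta_eq_one_of_mem L e dV hdV hdV0 dW hdW hdW0 𝒦
  have hM1 : modDelta L e dV hdV dW hdW (𝒦.pPart (locToAdelic L e dV hdV dW hdW v₀.1 (upd v₀))) = 1 := by
    rw [hupd₀, map_one, IwasawaDatum.modDelta_pPart_of_mem_K hK 𝒦.K.one_mem]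
  have hMrest : (∏ w : {w : T // w ≠ v₀}, modDelta L e dV hdV dW hdW (𝒦.pPart (locToAdelic L e dV hdV dW hdW w.1.1 (upd w.1)))) =
      ∏ w : {w : T // w ≠ v₀}, modDelta L e dV hdV dW hdW (𝒦.pPart (locToAdelic L e dV hdV dW hdW w.1.1 (y w.1))) :=
    Fintype.prod_congr _ _ fun w => by rw [hupd₁ w.1.1 w.1.2 w.2]
  have hM : modDelta L e dV hdV dW hdW (𝒦.pPart h₀) =
      modDelta L e dV hdV dW hdW (𝒦.pPart X) * modDelta L e dV hdV dW hdW (𝒦.pPart (locToAdelic L e dV hdV dW hdW v₀.1 (y v₀))) := by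
    rw [hh₀, hX, modDelta_pPart_placesEmbed L e dV hdV hdV0 dW hdW hdW0 T h𝒦 hKT yi y, modDelta_pPart_placesEmbed L e dV hdV hdV0 dW hdW hdW0 T h𝒦 hKT yi upd,
      Fintype.prod_eq_mul_prod_subtype_ne (fun v : T => modDelta L e dV hdV dW hdW (𝒦.pPart (locToAdelic L e dV hdV dW hdW v.1 (y v)))) v₀,
      Fintype.prod_eq_mul_prod_subtype_ne (fun v : T => modDelta L e dV hdV dW hdW (𝒦.pPart (locToAdelic L e dV hdV dW hdW v.1 (upd v)))) v₀,
      hM1, one_mul, hMrest]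
    ring
  -- (4) assemble
  rw [← hh₀, ← hX, stdExtension, hφ h₀, haway, hv0, hM, Complex.ofReal_mul,
    Complex.mul_cpow_ofReal_nonneg (modDelta_pos L e dV hdV dW hdW _).le (modDelta_pos L e dV hdV dW hdW _).le]
  ring

/-! ## §2 The same with the flat-family letters of the local factor exported -/

set_option maxHeartbeats 400000 in -- MEASURED: fails at the default 200 000 (`whnf` on the statement: §1's telescope + ★ `localDegPS`'s letters), passes at 400 000
include hdV0 hdW0 in
/-- **`hpure` WITH `bT` IDENTIFIED AS THE FLAT FAMILY THROUGH `b` (letters exported as conjuncts).**  Under §1's hypotheses and `b ∈ I_{v₀}(s₀, χ_{v₀})` (★ `localDegPS`):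
there are `bT`, `rT` with (i) ★ B2b FILE 2's `hpure`: `stdExtension 𝒦 s₀ φ s (placesEmbed_T (y_∞, y)) = bT s (y v₀) · rT s (y_∞, y|_{w≠v₀})` for all `s, y_∞, y`; (ii) `bT s` is a local
Siegel section of `I_{v₀}(s, χ_{v₀})` for EVERY `s` (★ `heightTwistLoc_siegel`); (iii) `bT s` is smooth (★ `heightTwistLoc_smooth`); (iv) `bT` is FLAT on `ι_{v₀}⁻¹(𝒦.K)`:
`ι_{v₀} k ∈ 𝒦.K → bT s k = bT s' k`; (v) `bT s₀ = b`; (vi) the formula `bT s u = H_{v₀}(u)^{2(s−s₀)} · b u`.  (ii)–(iv) are LH7-p06 (g2)'s `(hSieg, hsm, hflat)` binders in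
★ `K2LiuSingularWhittakerLocalReading.exists_twoStep_reading_of_forall_eq` for `K₀ ≤ ι_{v₀}⁻¹(𝒦.K)`. [cite: KudlaSweet1997, §1] [cite: Tan1999, §1 p. 166]
[cite: HarrisKudlaSweet1996, §1 (1.15)–(1.17)] -/
theorem exists_pureAt_placesEmbed_flat {𝒦 : IwasawaDatum L e dV hdV dW hdW} (h𝒦 : 𝒦.IsStd)
    (hKT : ∀ k ∈ 𝒦.K, ∀ v, v ∉ T → UnitaryGroup.evalPlace (Fp L) L (IsCMField.complexConj L) (n + n) (hermD L e dV hdV dW hdW) v (UnitaryGroup.finPart (Fp L) L (IsCMField.complexConj L) (n + n) (hermD L e dV hdV dW hdW) k) ∈ UnitaryGroup.localInt L (IsCMField.complexConj L) (n + n) (hermD L e dV hdV dW hdW) v)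
    (v₀ : T) {χ : HeckeCharacter L} (s₀ : ℂ) {φ a : HA L e dV hdV dW hdW → ℂ} {b : UnitaryGroup.localPi L (IsCMField.complexConj L) (n + n) (hermD L e dV hdV dW hdW) v₀.1 → ℂ}
    (hb : b ∈ localDegPS (Fp L) L (IsCMField.complexConj L) (complexConj_imagUnit L) (imagUnit_ne_zero L) (imagUnit_mul_self L)
          v₀.1 n (gramR_isSymm L e dV hdV dW hdW) (hermD_eq_map_gramD L e dV hdV dW hdW) (fun w => χ.localComponent w.1) s₀)
    (hφ : ∀ h : HA L e dV hdV dW hdW,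
      φ h = a (h * (locToAdelic L e dV hdV dW hdW v₀.1 (UnitaryGroup.evalPlace (Fp L) L (IsCMField.complexConj L) (n + n) (hermD L e dV hdV dW hdW) v₀.1 (UnitaryGroup.finPart (Fp L) L (IsCMField.complexConj L) (n + n) (hermD L e dV hdV dW hdW) h)))⁻¹) *
        b (UnitaryGroup.evalPlace (Fp L) L (IsCMField.complexConj L) (n + n) (hermD L e dV hdV dW hdW) v₀.1 (UnitaryGroup.finPart (Fp L) L (IsCMField.complexConj L) (n + n) (hermD L e dV hdV dW hdW) h))) :
    ∃ (bT : ℂ → UnitaryGroup.localPi L (IsCMField.complexConj L) (n + n) (hermD L e dV hdV dW hdW) v₀.1 → ℂ)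
      (rT : ℂ → UnitaryGroup.arch (Fp L) L (IsCMField.complexConj L) (n + n) (hermD L e dV hdV dW hdW) ×
        (Π w : {w : T // w ≠ v₀}, UnitaryGroup.localPi L (IsCMField.complexConj L) (n + n) (hermD L e dV hdV dW hdW) w.1.1) → ℂ),
      (∀ (s : ℂ) (yi : UnitaryGroup.arch (Fp L) L (IsCMField.complexConj L) (n + n) (hermD L e dV hdV dW hdW))
          (y : Π v : T, UnitaryGroup.localPi L (IsCMField.complexConj L) (n + n) (hermD L e dV hdV dW hdW) v.1),
        stdExtension 𝒦 s₀ φ s (placesEmbed L (hermD L e dV hdV dW hdW) T (yi, y)) = bT s (y v₀) * rT s (yi, fun w : {w : T // w ≠ v₀} => y w.1)) ∧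
      (∀ s : ℂ, Literature.NumberTheory.K2Lit.LocalSiegelDoubled.IsLocalSiegelSection (Fp L) L (IsCMField.complexConj L) (complexConj_imagUnit L) (imagUnit_ne_zero L)
          (imagUnit_mul_self L) v₀.1 n (gramR_isSymm L e dV hdV dW hdW) (hermD_eq_map_gramD L e dV hdV dW hdW) (fun w => χ.localComponent w.1) s (bT s)) ∧
      (∀ s : ℂ, Literature.NumberTheory.K2Lit.LocalSiegelDoubled.IsSmooth (Fp L) L (IsCMField.complexConj L) v₀.1 n (bT s)) ∧
      (∀ (s s' : ℂ) (k : UnitaryGroup.localPi L (IsCMField.complexConj L) (n + n) (hermD L e dV hdV dW hdW) v₀.1),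
        locToAdelic L e dV hdV dW hdW v₀.1 k ∈ 𝒦.K → bT s k = bT s' k) ∧
      bT s₀ = b ∧
      (∀ (s : ℂ) (u : UnitaryGroup.localPi L (IsCMField.complexConj L) (n + n) (hermD L e dV hdV dW hdW) v₀.1),
        bT s u = ((modDelta L e dV hdV dW hdW (𝒦.pPart (locToAdelic L e dV hdV dW hdW v₀.1 u)) : ℝ) : ℂ) ^ (2 * (s - s₀)) * b u) := by
  have hK : 𝒦.IsDeltaUnimodular := IwasawaDatum.modDelta_eq_one_of_mem L e dV hdV hdV0 dW hdW hdW0 𝒦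
  refine ⟨fun s u => ((modDelta L e dV hdV dW hdW (𝒦.pPart (locToAdelic L e dV hdV dW hdW v₀.1 u)) : ℝ) : ℂ) ^ (2 * (s - s₀)) * b u,
    fun s z => ((modDelta L e dV hdV dW hdW (𝒦.pPart (placesEmbed L (hermD L e dV hdV dW hdW) T
        (z.1, fun v : T => if hv : v = v₀ then (1 : UnitaryGroup.localPi L (IsCMField.complexConj L) (n + n) (hermD L e dV hdV dW hdW) v.1) else z.2 ⟨v, hv⟩))) : ℝ) : ℂ) ^ (2 * (s - s₀)) *
      a (placesEmbed L (hermD L e dV hdV dW hdW) T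
        (z.1, fun v : T => if hv : v = v₀ then (1 : UnitaryGroup.localPi L (IsCMField.complexConj L) (n + n) (hermD L e dV hdV dW hdW) v.1) else z.2 ⟨v, hv⟩)),
    fun s yi y => ?_, fun s => heightTwistLoc_siegel L e dV hdV hdV0 dW hdW hdW0 v₀.1 𝒦 hb s, fun s => heightTwistLoc_smooth L e dV hdV hdV0 dW hdW hdW0 v₀.1 h𝒦 hb.2 _,
    fun s s' k hk => ?_, ?_, fun s u => rfl⟩
  · exact stdExtension_placesEmbed_eq_mul_of_pureAt L e dV hdV hdV0 dW hdW hdW0 T h𝒦 hKT v₀ s₀ hφ s yi y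
  · show ((modDelta L e dV hdV dW hdW (𝒦.pPart (locToAdelic L e dV hdV dW hdW v₀.1 k)) : ℝ) : ℂ) ^ (2 * (s - s₀)) * b k =
      ((modDelta L e dV hdV dW hdW (𝒦.pPart (locToAdelic L e dV hdV dW hdW v₀.1 k)) : ℝ) : ℂ) ^ (2 * (s' - s₀)) * b k
    rw [IwasawaDatum.modDelta_pPart_of_mem_K hK hk, Complex.ofReal_one, Complex.one_cpow, Complex.one_cpow]
  · funext u
    show ((modDelta L e dV hdV dW hdW (𝒦.pPart (locToAdelic L e dV hdV dW hdW v₀.1 u)) : ℝ) : ℂ) ^ (2 * (s₀ - s₀)) * b u = b u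
    rw [sub_self, mul_zero, Complex.cpow_zero, one_mul]

end Summit.HodgeConjecture.HodgeConjecture.Cruxes.HLiu418.K2LiuStdExtensionPureAt

end
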